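import Literature.MathematicalPhysics.QuantumFieldTheory.Balaban1983to89.B7ConclGauge
import Literature.MathematicalPhysics.QuantumFieldTheory.Balaban1983to89.B7Eq208Analytic

/-!
# `Balaban1983to89.B7ConclGaugeLin` — T. Bałaban, *Averaging operations for lattice gauge theories*, Commun. Math. Phys. **98** (1985) 17–51
[Balaban1985Averaging]: **the abstract carrier `B7Eq214.GaugeLinData` (Sect. F in print's datum `λ = (1/i) log u′`, (207)–(214) p. 50) INSTANTIATED on the
concrete `ℤᵈ` objects of the lineage, and the decls of record `B7Eq214.Eq207Printed` ((207) ⇒ (176)–(177) with `4α₄`) and `B7Eq214.Eq214Printed`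
((208) analyticity + (213)–(214)) PROVED for this family** (model instance extending `B7ConclGauge.concreteGaugeData`).

statement-level skeleton of published theorems with citation tags; proofs where landed; nothing here is a claim about the Yang–Mills mass gap

CITATION HEADER (lean-in-tree rule).  Cell `lit-balaban`, unit `lit-balaban-r04` (owner of block B7, gen 6).  MODEL-INSTANCE file for SKELETON rows `B7.Eq207`
and `B7.Eq213` (decls of record `B7Eq214.Eq207Printed`, `B7Eq214.Eq214Printed`, abstract over `GaugeLinData`; no `GaugeLinData` family existed in the tree).
Kernels BY NAME: (207) ⇒ (176)/(177) for Banach-algebra elements — `B7Eq214.ineq176_of_207`, `B7Eq214.ineq177_of_207`; (208) «analytic functions of λ» at a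
general background — `B7Eq208Analytic.eq208_analyticOnNhd_ins`; (213)–(214) at a general background from (207) — `B7Eq214General.eq214_general_of207`
(`O₂ = 16C′_gen`, `C′_gen = B7Eq214General.Cgen d`).

PRINT (verbatim, p. 50).  "The assumptions (176), (177) can be reformulated in terms of the functions `λ = (1/i) log u′`. If we assume `|(D^η_{U₀}λ)(b)| < α₄,
|λ(x)| < α₄, λ(x) ∈ 𝔤ᶜ, α₄` sufficiently small, (207) then assumptions (176), (177) are satisfied with a constant `4α₄` instead of `α₄`. It is obvious from
the definition of the averaging operations that `ũ′ʲ` are analytic functions of `λ`, and `Q′_j(u₁, λ) = (1/i) log ũ′ʲ, j ≦ k`, (208) are analytic functions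
of `λ` also. … hence `Q′_j(u₁, λ, y) = (Q′_jλ)(y) + C′_j(u₁, λ, y)`, (213) `|C′_j(u₁, λ, y)| = O((α₃α₄ + α₄²)Lʲη)`. (214)"

THE FAMILY `concreteGaugeLinData 𝔸 L` (𝔸 a C⋆-algebra — print's `M_N(ℂ)` —, `G = U(𝔸)`; index `i = (k, U₀)` exactly as for `B7ConclGauge.concreteGaugeData`,
whose fields it EXTENDS unchanged): `Alg` = BOUNDED `𝔸`-valued site functions `λ` on `ℤᵈ` («`λ(x) ∈ 𝔤ᶜ`», the bound making `sup_x|λ(x)|` a genuine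
supremum; `𝔤ᶜ` read as the ambient algebra, READING (R1) of `B7Eq214`); `expI λ = (x ↦ e^{λ(x)})` (`B7Prop1Explicit.expUnit`; print's `u′ = e^{iλ}` with the
`i` absorbed into `λ`, as everywhere in the lineage); `lamSup λ = sup_x‖λ(x)‖`; `covDerivSup V λ = sup_b‖(D^η_V λ)(b)‖ = sup_b η⁻¹‖R(V(b))λ(b₊) − λ(b₋)‖`
(the covariant `η`-lattice derivative, (56) `R(X)Y = XYX⁻¹ = B7Eq170Flat.cj`, `η = L^{−k}`); `IsAnalyticQp V u₁ j r` = «`Q′_j(u₁, λ) = log ũ′ʲ` is analytic in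
`λ` on the (207)-domain of size `r`» READ on the coordinates `(λ_x)_{x∈S} ∈ 𝔸^S` for every finite `S ⊂ ℤᵈ` (`B7Eq208Analytic.insSite`; `AnalyticOnNhd ℂ` of
`a ↦ log ũ′ʲ(z)`, `ũ′ʲ = B7Prop10General.utilG`, on `{a | ‖R(V(b))λ_a(b₊) − λ_a(b₋)‖ < rη, ‖λ_a(x)‖ < r}`); `remDev V u₁ λ j = sup_z‖log ũ′ʲ(z) − (Q′_jλ)(z)‖`
(`= sup_y|C′_j(u₁, λ, y)|` of (213), `Q′_jλ = B7Eq214General.lamAvgG`).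

WHAT THIS FILE PROVES (kernel, no `sorry`, standard axioms).
* `eq207Printed_GL (hL : 1 ≤ L) : B7Eq214.Eq207Printed (concreteGaugeLinData 𝔸 L)` — `c₇ = 1/4`: (207) ⇒ (176) `‖e^{λ(x)} − 1‖ ≤ 4α₄` and (177)
  `‖e^{−λ(b₋)}R(U₀(b))e^{λ(b₊)} − 1‖ ≤ 4α₄η` (`ineq176_of_207`, `ineq177_of_207`, `η ≤ 1`).
* `eq214Printed_GL (hL : 2 ≤ L) : B7Eq214.Eq214Printed (concreteGaugeLinData 𝔸 L)` — `O₂ = 16·Cgen d`, `c₇ = cGL d L` explicit (the minimum of Prop. 2's `c₂`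
  and the smallness conditions of `eq208_analyticOnNhd_ins` / `eq214_general_of207`); for the index's background with the finer (52) `plaqDevEta < α₀ ≤ c₇`, a
  unitary `u₁ ∈ Λ_k(U₀, α₃)` and `λ` in the (207)-domain: analyticity of every `Q′_j`, `j ≤ k`, on the (207)-domain in each coordinate patch `𝔸^S`, and
  `sup_z‖log ũ′ʲ(z) − (Q′_jλ)(z)‖ ≤ 16C′_gen(α₃α₄ + α₄²)Lʲη`.
* `eq207_and_eq214_GL` — the conjunction.
READINGS (located, inherited from `B7Eq214` (R1)–(R5) and `B7ConclGauge`): Banach/C⋆ carriers; `𝔤ᶜ` = the ambient algebra; analyticity on finite coordinate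
patches; the index convention `i = (k, U₀)`, `Cfg i = {V // V = U₀}`.  NOT CLAIMED: the printed absolute constants; anything `L`-uniform.
DECLARATIONS: `BddSite`, `norm_cj_le_of_mem_U1`, `covDeriv_bddAbove`, `concreteGaugeLinData`, `cGL`, theorems.  Unit `lit-balaban-r04` (gen 6), 2026-08-21.

[cite: Balaban1985Averaging, (207)–(208) p.50, (213)–(214) p.50, (176)–(177) p.45, (166)–(167) p.44, (52) p.26]
-/

noncomputable section

open scoped BigOperators
open NormedSpace Finset

namespace Literature.MathematicalPhysics.QuantumFieldTheory.Balaban1983to89.B7ConclGaugeLin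

open B7Prop1Explicit B7Prop2Explicit B7Eq92Concrete B7Eq99Concrete B7Eq84Concrete B7Eq167Flat B7Prop9Flat B7Prop9General
  B7Prop10General B7Eq214General B7Eq208Analytic B7ConclGauge MatrixLog
open B7Prop10Flat (C5 C5'_nonneg one_le_C5)
open B7Eq170Flat (cj cj_apply val_Rc_eq_cj mlog_exp_of_le)

-- `Site` alone would resolve to the torus sites of `Setup.lean`; re-export the `ℤ^d` sites of `B7Prop1Explicit`.
export B7Prop1Explicit (Site)

variable {d : ℕ}

/-! ## §1 Bounded site functions `λ` and the covariant lattice derivative -/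

/-- BOUNDED `𝔸`-valued site functions `λ` on `ℤᵈ` — print's «`λ(x) ∈ 𝔤ᶜ`, `|λ(x)| < α₄`» (207); the bound makes `sup_x|λ(x)|` and `sup_b|(D^η_{U₀}λ)(b)|`
genuine suprema. [cite: Balaban1985Averaging, (207) p.50] -/
def BddSite (d : ℕ) (𝔸 : Type) [Norm 𝔸] : Type :=
  {lam : Site d → 𝔸 // BddAbove (Set.range fun x : Site d => ‖lam x‖)}

section Elementary

variable {𝔸 : Type} [NormedRing 𝔸] [NormOneClass 𝔸]

/-- `‖R(T)X‖ = ‖TXT⁻¹‖ ≤ ‖X‖` for `T` with `‖T‖, ‖T⁻¹‖ ≤ 1` ((56) `R(T)X = TXT⁻¹`). [cite: Balaban1985Averaging, (56) p.27] -/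
theorem norm_cj_le_of_mem_U1 {T : 𝔸ˣ} (hT : T ∈ U1 𝔸) (X : 𝔸) : ‖cj T X‖ ≤ ‖X‖ := by
  obtain ⟨h1, h2⟩ := mem_U1.1 hT
  rw [cj_apply]
  calc ‖(T : 𝔸) * X * ((T⁻¹ : 𝔸ˣ) : 𝔸)‖ ≤ ‖(T : 𝔸)‖ * ‖X‖ * ‖((T⁻¹ : 𝔸ˣ) : 𝔸)‖ := norm_mul₃_le
    _ ≤ 1 * ‖X‖ * 1 := by gcongr
    _ = ‖X‖ := by ring

/-- the covariant lattice derivatives `c·‖R(V(b))λ(b₊) − λ(b₋)‖` (`c ≥ 0`, e.g. `c = η⁻¹`) of a bounded `λ` over a `U1`-valued background are bounded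
(`sup_b|(D^η_{V}λ)(b)|` is a genuine supremum). [cite: Balaban1985Averaging, (207) p.50, (56) p.27] -/
theorem covDeriv_bddAbove {V : Site d → Fin d → 𝔸ˣ} (hV : ∀ (x : Site d) (κ : Fin d), V x κ ∈ U1 𝔸) (lam : BddSite d 𝔸) {c : ℝ}
    (hc : 0 ≤ c) :
    BddAbove (Set.range fun b : Site d × Fin d => c * ‖cj (V b.1 b.2) (lam.1 (b.1 + e b.2)) - lam.1 b.1‖) := by
  obtain ⟨M, hM⟩ := lam.2
  refine ⟨c * (M + M), ?_⟩
  rintro _ ⟨b, rfl⟩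
  have h1 : ‖lam.1 (b.1 + e b.2)‖ ≤ M := hM (Set.mem_range_self _)
  have h2 : ‖lam.1 b.1‖ ≤ M := hM (Set.mem_range_self _)
  exact mul_le_mul_of_nonneg_left
    ((norm_sub_le _ _).trans (add_le_add ((norm_cj_le_of_mem_U1 (hV _ _) _).trans h1) h2)) hc

end Elementary

/-! ## §2 The family of Sect. F in the datum `λ` -/

section Family

variable (𝔸 : Type) [CStarAlgebra 𝔸] [Nontrivial 𝔸]

/-- **The concrete `λ`-family of Sect. F** (see the module docstring for every field): `B7ConclGauge.concreteGaugeData 𝔸 L i` EXTENDED by `Alg` = bounded site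
functions `λ`, `expI λ = e^{λ}`, `lamSup λ = sup_x‖λ(x)‖`, `covDerivSup V λ = sup_b η⁻¹‖R(V(b))λ(b₊) − λ(b₋)‖`, `IsAnalyticQp V u₁ j r` = analyticity of
`(λ_x)_{x∈S} ↦ log ũ′ʲ(z)` on the (207)-domain of size `r` for every finite `S` and every `z`, `remDev V u₁ λ j = sup_z‖log ũ′ʲ(z) − (Q′_jλ)(z)‖`.
[cite: Balaban1985Averaging, (207)–(208) p.50, (213) p.50, (56) p.27] -/
def concreteGaugeLinData (L : ℕ) (i : GIdx 𝔸 d L) : B7Eq214.GaugeLinData where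
  toGaugeData := concreteGaugeData 𝔸 L i
  Alg := BddSite d 𝔸
  expI lam := fun x : Site d => expUnit (lam.1 x)
  lamSup lam := ⨆ x : Site d, ‖lam.1 x‖
  covDerivSup V lam := ⨆ b : Site d × Fin d, (L : ℝ) ^ i.k * ‖cj (V.1 b.1 b.2) (lam.1 (b.1 + e b.2)) - lam.1 b.1‖
  IsAnalyticQp V u₁ j r := ∀ (S : Finset (Site d)) (z : Site d),
    AnalyticOnNhd ℂ (fun a : S → 𝔸 => mlog ((utilG L V.1 (fun x => expUnit (insSite S a x)) u₁ j z : 𝔸ˣ) : 𝔸))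
      {a | (∀ (x : Site d) (κ : Fin d), ‖cj (V.1 x κ) (insSite S a (x + e κ)) - insSite S a x‖ < r * ((L : ℝ) ^ i.k)⁻¹) ∧
        ∀ x : Site d, ‖insSite S a x‖ < r}
  remDev V u₁ lam j := ⨆ z : Site d,
    ‖mlog ((utilG L V.1 (fun x => expUnit (lam.1 x)) u₁ j z : 𝔸ˣ) : 𝔸) - lamAvgG L V.1 j lam.1 z‖

end Family

/-! ## §3 The threshold `c₇` -/

/-- the threshold `c₇ = c₇(d, L)` of (207)/(214): the minimum of Prop. 2's `c₂` (`B7ConclGauge.cB`) and the explicit smallness conditions of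
`B7Eq208Analytic.eq208_analyticOnNhd_ins` and `B7Eq214General.eq214_general_of207`. [cite: Balaban1985Averaging, (207) p.50, (214) p.50, Proposition 10 p.50] -/
def cGL (d L : ℕ) : ℝ :=
  min (cB d L) <| min (1 / 200) <| min (1 / (200 * C6 d)) <| min (1 / (12000 * ((d : ℝ) + 1) * (L : ℝ))) <| min (1 / (6 * C4G d L)) <|
    min (1 / (1024 * ((d : ℝ) + 1) * ((d : ℝ) + 4) * (L : ℝ) ^ 2)) <| min (1 / (32 * ((d : ℝ) + 1) ^ 2 * C6 d * (L : ℝ) ^ 2)) <|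
    min (1 / (16 * ((d : ℝ) + 1) * C5' d * C6 d * (L : ℝ) ^ 2)) (1 / (8 * ((d : ℝ) + 1) * C6 d * (L : ℝ)))

/-- `C₆ ≥ 2` (`C₆ = C₅ + 1`, `C₅ ≥ 1`). [cite: Balaban1985Averaging, (204) p.49] -/
theorem two_le_C6' : (2 : ℝ) ≤ C6 d := by
  unfold C6; linarith [one_le_C5 (d := d)]

/-- `C₄(d, L) > 0` (`B7Prop10General.C4G`). [cite: Balaban1985Averaging, (203)–(205) p.49] -/
theorem C4G_pos' (d L : ℕ) : 0 < C4G d L := by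
  have h6 : 0 < C6 d := by linarith [two_le_C6' (d := d)]
  have h5' := C5'_nonneg (d := d)
  have h7 : 0 < C7 d := by unfold C7; linarith
  have h4' : 0 < B7Prop9Flat.C4' d := by unfold B7Prop9Flat.C4'; positivity
  have hL : (0 : ℝ) ≤ L := Nat.cast_nonneg L
  unfold C4G
  positivity

/-- `cGL > 0` (`L ≥ 1`). [cite: Balaban1985Averaging, (207) p.50, (214) p.50] -/
theorem cGL_pos (d : ℕ) {L : ℕ} (hL : 1 ≤ L) : 0 < cGL d L := by
  have hL0 : (0 : ℝ) < L := by exact_mod_cast hL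
  have h6 : 0 < C6 d := by linarith [two_le_C6' (d := d)]
  have h5' : 0 < C5' d := by unfold C5'; positivity
  have h4 := C4G_pos' d L
  unfold cGL
  exact lt_min (cB_pos d hL) (lt_min (by norm_num) (lt_min (by positivity) (lt_min (by positivity) (lt_min (by positivity)
    (lt_min (by positivity) (lt_min (by positivity) (lt_min (by positivity) (by positivity))))))))

/-- unpacking `cGL`. [cite: Balaban1985Averaging, (207) p.50, (214) p.50] -/
theorem cGL_le (d L : ℕ) :
    cGL d L ≤ cB d L ∧ cGL d L ≤ 1 / 200 ∧ cGL d L ≤ 1 / (200 * C6 d) ∧ cGL d L ≤ 1 / (12000 * ((d : ℝ) + 1) * (L : ℝ)) ∧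
      cGL d L ≤ 1 / (6 * C4G d L) ∧ cGL d L ≤ 1 / (1024 * ((d : ℝ) + 1) * ((d : ℝ) + 4) * (L : ℝ) ^ 2) ∧
      cGL d L ≤ 1 / (32 * ((d : ℝ) + 1) ^ 2 * C6 d * (L : ℝ) ^ 2) ∧ cGL d L ≤ 1 / (16 * ((d : ℝ) + 1) * C5' d * C6 d * (L : ℝ) ^ 2) ∧
      cGL d L ≤ 1 / (8 * ((d : ℝ) + 1) * C6 d * (L : ℝ)) := by
  unfold cGL
  refine ⟨min_le_left _ _, ?_, ?_, ?_, ?_, ?_, ?_, ?_, ?_⟩ <;> simp only [min_le_iff, le_refl, true_or, or_true]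

/-! ## §4 (207) ⇒ (176)–(177), (208) and (213)–(214) for the family -/

section Props

variable {𝔸 : Type} [CStarAlgebra 𝔸] [Nontrivial 𝔸]

/-- unpacking (207) for the family: `covDerivSup U₀ λ < α₄` and `lamSup λ < α₄` give the pointwise (207) `‖R(U₀(b))λ(b₊) − λ(b₋)‖ < α₄η`, `‖λ(x)‖ < α₄`.
[cite: Balaban1985Averaging, (207) p.50] -/
theorem h207_of_sup {L : ℕ} (hL : 1 ≤ L) {k : ℕ} {U₀ : Site d → Fin d → 𝔸ˣ} (hU₀ : ∀ (x : Site d) (κ : Fin d), U₀ x κ ∈ unitaryUnits 𝔸)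
    (lam : BddSite d 𝔸) {α₄ : ℝ}
    (hcov : (⨆ b : Site d × Fin d, (L : ℝ) ^ k * ‖cj (U₀ b.1 b.2) (lam.1 (b.1 + e b.2)) - lam.1 b.1‖) < α₄)
    (hsup : (⨆ x : Site d, ‖lam.1 x‖) < α₄) :
    (∀ (x : Site d) (κ : Fin d), ‖cj (U₀ x κ) (lam.1 (x + e κ)) - lam.1 x‖ < α₄ * ((L : ℝ) ^ k)⁻¹) ∧ ∀ x : Site d, ‖lam.1 x‖ < α₄ := by
  have hL0 : (0 : ℝ) < L := by exact_mod_cast hL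
  have hU1 : ∀ (x : Site d) (κ : Fin d), U₀ x κ ∈ U1 𝔸 := fun x κ => unitaryUnits_le_U1 (hU₀ x κ)
  have hb := covDeriv_bddAbove hU1 lam (c := (L : ℝ) ^ k) (by positivity)
  refine ⟨fun x κ => ?_, fun x => lt_of_le_of_lt (le_ciSup lam.2 x) hsup⟩
  have h1 : (L : ℝ) ^ k * ‖cj (U₀ x κ) (lam.1 (x + e κ)) - lam.1 x‖ < α₄ := lt_of_le_of_lt (le_ciSup hb (x, κ)) hcov
  rw [← div_eq_mul_inv, lt_div_iff₀ (by positivity), mul_comm]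
  exact h1

/-- **(207) ⇒ (176)–(177) with `4α₄` AS TYPED (`B7Eq214.Eq207Printed`) for `concreteGaugeLinData 𝔸 L`** (`L ≥ 1`): `c₇ = 1/4`.  For `λ` with
`sup_b|(D^η_{U₀}λ)(b)| < α₄`, `sup_x|λ(x)| < α₄ ≤ 1/4`: (176) `‖e^{λ(x)} − 1‖ ≤ 4α₄` (`B7Eq214.ineq176_of_207`) and (177)
`‖e^{−λ(b₋)}R(U₀(b))e^{λ(b₊)} − 1‖ ≤ 4α₄η` (`B7Eq214.ineq177_of_207`, `η = L^{−k} ≤ 1`). [cite: Balaban1985Averaging, (207) p.50, (176)–(177) p.45] -/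
theorem eq207Printed_GL (L : ℕ) (hL : 1 ≤ L) : B7Eq214.Eq207Printed (concreteGaugeLinData 𝔸 (d := d) L) := by
  have hLr : (1 : ℝ) ≤ L := by exact_mod_cast hL
  refine ⟨1 / 4, by norm_num, ?_⟩
  rintro ⟨k, U₀, hU₀, h52B⟩ α₄ hα₄ hα₄c ⟨V, hVU⟩ lam hcov hsup
  dsimp only [concreteGaugeLinData, concreteGaugeData] at hVU lam hcov hsup ⊢
  subst hVU
  have hη1 : ((L : ℝ) ^ k)⁻¹ ≤ 1 := inv_le_one_of_one_le₀ (one_le_pow₀ hLr)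
  obtain ⟨h207a, h207b⟩ := h207_of_sup hL hU₀ lam hcov hsup
  refine ⟨fun x => ?_, fun x κ => ?_⟩
  · show ‖((expUnit (lam.1 x) : 𝔸ˣ) : 𝔸) - 1‖ ≤ 4 * α₄
    rw [val_expUnit]
    exact (B7Eq214.ineq176_of_207 (lam.1 x) hα₄c (h207b x)).le
  · show ‖((((expUnit (lam.1 x))⁻¹ * Rc (V x κ) (expUnit (lam.1 (x + e κ))) : 𝔸ˣ)) : 𝔸) - 1‖ ≤ 4 * α₄ * ((L : ℝ) ^ k)⁻¹
    rw [Units.val_mul, val_inv_expUnit, val_Rc_eq_cj, val_expUnit, cj_apply]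
    exact (B7Eq214.ineq177_of_207 (V x κ) (lam.1 x) (lam.1 (x + e κ)) hα₄c hη1 (h207b x) (h207a x κ)).le

/-- the `α`-regime below `c₇ = cGL d L` (`L ≥ 1`): Prop. 2's hypotheses `C₀α₀ ≤ ⅓`, `2α₀ ≤ c₂′`, `α₃ ≤ 1/200`, and the smallness conditions of
`B7Eq208Analytic.eq208_analyticOnNhd_ins` / `B7Eq214General.eq214_general_of207`. [cite: Balaban1985Averaging, (207) p.50, (214) p.50, Proposition 2 p.26] -/
theorem cGL_regime {L : ℕ} (hL : 1 ≤ L) {α₀ α₃ α₄ : ℝ} (hα₀ : 0 < α₀) (hα₀c : α₀ ≤ cGL d L) (hα₃c : α₃ ≤ cGL d L)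
    (hα₄ : 0 < α₄) (hα₄c : α₄ ≤ cGL d L) :
    (C0 d * α₀ ≤ 1 / 3 ∧ 2 * α₀ ≤ c2' d L ∧ α₃ ≤ 1 / 200) ∧
    (200 * C6 d * α₄ ≤ 1 ∧ 40 * C6 d * α₄ ≤ 1 ∧ 12000 * ((d : ℝ) + 1) * L * α₄ ≤ 1 ∧ C4G d L * (α₀ + α₃ + 4 * α₄) ≤ 1) ∧
    (1024 * ((d : ℝ) + 1) * ((d : ℝ) + 4) * (L : ℝ) ^ 2 * α₀ ≤ 1 ∧ 32 * ((d : ℝ) + 1) ^ 2 * C6 d * (L : ℝ) ^ 2 * α₀ ≤ 1 ∧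
      16 * d * C5' d * C6 d * (L : ℝ) ^ 2 * α₀ ≤ 1 ∧ 8 * d * C6 d * L * α₀ ≤ 1) := by
  have hL0 : (0 : ℝ) < L := by exact_mod_cast hL
  have hd : (0 : ℝ) ≤ d := Nat.cast_nonneg d
  have hC6 : 0 < C6 d := by linarith [two_le_C6' (d := d)]
  have hC5' : 0 < C5' d := by unfold C5'; positivity
  have hC4G := C4G_pos' d L
  obtain ⟨cBle, c200, c200C6, c12000, c6C4G, c1024, c32, c16, c8⟩ := cGL_le d L
  obtain ⟨hB3, hB2⟩ := cB_spec d L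
  have hα₀B : α₀ ≤ cB d L := hα₀c.trans cBle
  have hC60 : 0 < C6 d * α₄ := mul_pos hC6 hα₄
  refine ⟨⟨(mul_le_mul_of_nonneg_left hα₀B (C0_pos d).le).trans hB3, by linarith, hα₃c.trans c200⟩, ⟨?_, ?_, ?_, ?_⟩, ⟨?_, ?_, ?_, ?_⟩⟩
  · have h := hα₄c.trans c200C6
    rw [le_div_iff₀ (by positivity)] at h
    linarith
  · have h := hα₄c.trans c200C6
    rw [le_div_iff₀ (by positivity)] at h
    linarith
  · have h := hα₄c.trans c12000
    rw [le_div_iff₀ (by positivity)] at h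
    linarith
  · have h0 := hα₀c.trans c6C4G
    have h3 := hα₃c.trans c6C4G
    have h4 := hα₄c.trans c6C4G
    rw [le_div_iff₀ (by positivity)] at h0 h3 h4
    linarith
  · have h := hα₀c.trans c1024
    rw [le_div_iff₀ (by positivity)] at h
    linarith
  · have h := hα₀c.trans c32
    rw [le_div_iff₀ (by positivity)] at h
    linarith
  · have h := hα₀c.trans c16
    rw [le_div_iff₀ (by positivity)] at h
    have : 0 ≤ C5' d * C6 d * (L : ℝ) ^ 2 * α₀ := by positivity
    linarith
  · have h := hα₀c.trans c8
    rw [le_div_iff₀ (by positivity)] at h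
    have : 0 ≤ C6 d * L * α₀ := by positivity
    linarith

/-- **(208) + (213)–(214) AS TYPED (`B7Eq214.Eq214Printed`) for `concreteGaugeLinData 𝔸 L`** (`L ≥ 2`; `𝔸` a C⋆-algebra, `G = U(𝔸)`): `O₂ = 16·C′_gen`
(`B7Eq214General.Cgen d`), `c₇ = cGL d L`.  For the index's background with the finer (52) `plaqDevEta < α₀ ≤ c₇`, a unitary `u₁ ∈ Λ_k(U₀, α₃)`, `α₃, α₄ ≤ c₇`:
(208) every `Q′_j(u₁, ·)`, `j ≤ k`, is analytic on the (207)-domain of size `α₄` in each coordinate patch `𝔸^S` (`B7Eq208Analytic.eq208_analyticOnNhd_ins`),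
and for `λ` in the (207)-domain `sup_z‖log ũ′ʲ(z) − (Q′_jλ)(z)‖ ≤ 16C′_gen(α₃α₄ + α₄²)Lʲη` (`B7Eq214General.eq214_general_of207`, the supremum by
`Real.iSup_le`). [cite: Balaban1985Averaging, (208) p.50, (213)–(214) p.50, (207) p.50, (166)–(167) p.44, (52) p.26] -/
theorem eq214Printed_GL (L : ℕ) (hL : 2 ≤ L) : B7Eq214.Eq214Printed (concreteGaugeLinData 𝔸 (d := d) L) := by
  have hL1 : 1 ≤ L := le_trans (by norm_num) hL
  have hL0 : (0 : ℝ) < L := by exact_mod_cast hL1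
  have hC6 : 0 < C6 d := by linarith [two_le_C6' (d := d)]
  have hCg : 0 < Cgen d := by unfold Cgen; positivity
  refine ⟨16 * Cgen d, cGL d L, by positivity, cGL_pos d hL1, ?_⟩
  rintro ⟨k, U₀, hU₀, h52B⟩ α₀ α₃ α₄ hα₀ hα₀c hα₃ hα₃c hα₄ hα₄c ⟨V, hVU⟩ u₁ hdev ⟨hu₁, hΛ⟩
  dsimp only [concreteGaugeLinData, concreteGaugeData] at hVU u₁ hdev hΛ ⊢
  subst hVU
  obtain ⟨⟨hα3, hα2, hα₃'⟩, ⟨hs₁, hs₁', hs₂, hs₃⟩, ⟨hs₄, hs₅, hs₆, hs₇⟩⟩ := cGL_regime (d := d) hL1 hα₀ hα₀c hα₃c hα₄ hα₄c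
  have h52 := h52_of_lt hL1 hdev
  refine ⟨fun j hj S z => ?_, fun lam hcov hsup j hj => ?_⟩
  · -- (208): analyticity of `Q′_j(u₁, ·)` on the (207)-domain, coordinates `(λ_x)_{x∈S}`
    exact eq208_analyticOnNhd_ins S hL (avgClosed_unitaryUnits d L) hU₀ hα₀ hα3 hα2 h52 hΛ hα₃.le (hα₃'.trans (by norm_num)) hs₁' hs₂ hs₃
      hs₄ hs₅ hs₆ hj z
  · -- (213)–(214)
    obtain ⟨h207a, h207b⟩ := h207_of_sup hL1 hU₀ lam hcov hsup
    have h := eq214_general_of207 hL (avgClosed_unitaryUnits d L) hU₀ hα₀ hα3 hα2 h52 h207a h207b hΛ hα₃.le hα₃' hs₁ hs₂ hs₃ hs₄ hs₅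
      hs₆ hs₇ j hj
    have ht : 0 ≤ (L : ℝ) ^ j * ((L : ℝ) ^ k)⁻¹ := by positivity
    exact Real.iSup_le h (by positivity)

/-- **The two `λ`-conjuncts for ONE family**: `Eq207Printed ∧ Eq214Printed` for `concreteGaugeLinData 𝔸 L`, `L ≥ 2`.
[cite: Balaban1985Averaging, (207)–(208) p.50, (213)–(214) p.50] -/
theorem eq207_and_eq214_GL (L : ℕ) (hL : 2 ≤ L) :
    B7Eq214.Eq207Printed (concreteGaugeLinData 𝔸 (d := d) L) ∧ B7Eq214.Eq214Printed (concreteGaugeLinData 𝔸 (d := d) L) :=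
  ⟨eq207Printed_GL L (le_trans (by norm_num) hL), eq214Printed_GL L hL⟩

end Props

end Literature.MathematicalPhysics.QuantumFieldTheory.Balaban1983to89.B7ConclGaugeLin

end
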